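import Literature.NumberTheory.Kottwitz1992.HermitianSymmetricSpacesLemma42Holds
import HarnessLib

/-!
# [Kottwitz1992, Lemma 4.3 p. 388] Positive `*`-homomorphisms `ℂ → End_B(V)` are conjugate under `G₁(ℝ)` — DISCHARGED:
# `Kottwitz1992_4_3_conj_holds`

Kernel-lane companion of the statement carpet ★ `Literature/NumberTheory/Kottwitz1992/HermitianSymmetricSpaces.lean` (squad TK, TK-t02;
builds on ★ `HermitianSymmetricSpacesLemma42Holds`, the first statement of Lemma 4.2): the named fact ★
`HermitianSymmetricSpaces.Kottwitz1992_4_3_conj` — «Suppose that `B, *, V, ⟨·,·⟩, h` are as before and that `h′ : ℂ → C` is another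
`*`-homomorphism such that `⟨v, h′(i)w⟩` is positive definite. Then `h′` and `h` are conjugate under `G₁(ℝ)`» (a `B`-linear isometry `c`
of `(V, ⟨·,·⟩)` with `c h(z) c⁻¹ = h′(z)`) — is PROVED here as `theorem Kottwitz1992_4_3_conj_holds : Kottwitz1992_4_3_conj`.  THEOREMS
ONLY (no definition, no named fact, no `sorry`, no instance, no notation); cell hodgecm-mathlib, seat B-typ04 (g30); net debt −1.

R. E. Kottwitz, *Points on some Shimura varieties over finite fields*, J. Amer. Math. Soc. 5 (1992), Lemma 4.3 p. 388, proof p. 388 L21 –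
p. 389 L6 (held `paper:doi-10-2307-2152772`, p0016–p0017).  THE PRINTED PROOF: «We begin by checking that it is enough to prove that
`h, h′` are conjugate under `C^×`, or, equivalently, that the `B ⊗_ℝ ℂ`-module structures on `V` obtained from `h, h′` are isomorphic.
Indeed, by the proof of the first statement of the previous lemma it would then follow that there exists `c ∈ C^×` conjugating `h` into
`h′` and such that `⟨v, w⟩ = ⟨cv, cw⟩` for all `v, w ∈ V`, which means that `c ∈ G₁(ℝ)`.  It remains to show that `h, h′` are conjugate
under `C^×`. By decomposing `(B, *)` as a product of simple `ℝ`-algebras with positive involution … If this center is `ℝ`, then `h` and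
`h′` are conjugate under `C^×` by the Skolem–Noether theorem … It remains to treat the case that the center of `B` is `ℂ` … it is enough
to show that `(p, q)` is the signature of `⟨·,·⟩′` …»
FOLLOWED for its first step, verbatim: the reduction to an isomorphism of the two `B ⊗_ℝ ℂ`-module structures is the first statement of
Lemma 4.2 with `⟨·,·⟩′ = ⟨·,·⟩` — the tree's ★ `Kottwitz1992_4_2_iso_holds`.  DECLARED DEVIATION for the second step (a genuinely shorter
road than the printed reduction to simple factors, Skolem–Noether and the `(p, q)`-signature count of pp. 388–389): the module isomorphism
is written down directly — `f = h(i) + h′(i)` is `B`-linear, satisfies `f ∘ h(i) = h(i)² + h′(i) h(i) = −1 + h′(i) h(i) = h′(i) ∘ f`, hence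
`f ∘ h(z) = h′(z) ∘ f` for all `z = x + iy ∈ ℂ` (`h(z) = x + y h(i)`), and `f` is injective, hence bijective, by the two positivity
conditions: `⟨v, f v⟩ = ⟨v, h(i)v⟩ + ⟨v, h′(i)v⟩ > 0` for `v ≠ 0`.
HONEST LABEL: HC_CM is proved only modulo the 7 printed citations (2 remaining: hLiu418, h413) until rung 0 closes; this file adds no citation
debt (0 facts, 0 sorry) and discharges 1 named fact of ★ `HermitianSymmetricSpaces`.

## References
* [Kottwitz1992] R. E. Kottwitz, Points on some Shimura varieties over finite fields, J. Amer. Math. Soc. 5 (1992) 373–444, Lemma 4.3 and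
  its proof, pp. 388–389; Lemma 4.2 p. 387.
-/

noncomputable section

namespace Literature.NumberTheory.Kottwitz1992.HermitianSymmetricSpaces

universe u v

/-- An `ℝ`-algebra map `θ : ℂ → A` is `θ(x + iy) = x + y θ(i)`. [folklore] -/
private theorem algHom_complex_apply {A : Type*} [Ring A] [Algebra ℝ A] (θ : ℂ →ₐ[ℝ] A) (z : ℂ) :
    θ z = algebraMap ℝ A z.re + z.im • θ Complex.I := by
  conv_lhs => rw [← Complex.re_add_im z]
  rw [map_add, map_mul, AlgHom.map_coe_real_complex, AlgHom.map_coe_real_complex, Algebra.algebraMap_eq_smul_one z.im,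
    smul_mul_assoc, one_mul]

/-- **Lemma 4.3, PROVED**: ★ `Kottwitz1992_4_3_conj` holds — two `*`-homomorphisms `h, h′ : ℂ → C = End_B(V)` with `⟨v, h(i)w⟩`,
`⟨v, h′(i)w⟩` positive definite are conjugate by a `B`-linear isometry of `(V, ⟨·,·⟩)`.  As printed, it is enough (first statement of
Lemma 4.2, ★ `Kottwitz1992_4_2_iso_holds`) that the two `B ⊗_ℝ ℂ`-module structures be isomorphic; the isomorphism is `f = h(i) + h′(i)`
(declared shorter road, see the module docstring). [cite: Kottwitz1992, Lemma 4.3 (p. 388)] -/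
theorem Kottwitz1992_4_3_conj_holds : Kottwitz1992_4_3_conj.{u, v} := by
  intro B _ _ _ _ _ _ V _ _ _ ρ ψ η η' hposB
  /- the module isomorphism `f = h(i) + h′(i)` -/
  obtain ⟨f₀, hf₀⟩ : ∃ f₀ : Module.End ℝ V, f₀ = η.h Complex.I + η'.h Complex.I := ⟨_, rfl⟩
  have hJJ : η.h Complex.I * η.h Complex.I = -1 := by rw [← map_mul, Complex.I_mul_I, map_neg, map_one]
  have hJJ' : η'.h Complex.I * η'.h Complex.I = -1 := by rw [← map_mul, Complex.I_mul_I, map_neg, map_one]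
  -- `f h(i) = h′(i) f`
  have hfI : f₀ * η.h Complex.I = η'.h Complex.I * f₀ := by
    rw [hf₀, add_mul, mul_add, hJJ, hJJ', add_comm]
  -- `f h(z) = h′(z) f`
  have hfz : ∀ z : ℂ, f₀ * η.h z = η'.h z * f₀ := fun z => by
    rw [algHom_complex_apply η.h z, algHom_complex_apply η'.h z, mul_add, add_mul, mul_smul_comm, smul_mul_assoc, hfI,
      ← Algebra.commutes]
  -- `f` is `B`-linear
  have hfρ : ∀ b : B, f₀ * ρ b = ρ b * f₀ := fun b => by rw [hf₀, add_mul, mul_add, η.comm, η'.comm]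
  -- `f` is injective by positivity: `⟨v, f v⟩ = ⟨v, h(i)v⟩ + ⟨v, h′(i)v⟩ > 0`
  have hinj : Function.Injective f₀ := by
    rw [injective_iff_map_eq_zero]
    intro x hx
    by_contra hx0
    have hpos := add_pos (η.pos x hx0) (η'.pos x hx0)
    rw [← map_add, ← LinearMap.add_apply, ← hf₀, hx, map_zero] at hpos
    exact lt_irrefl 0 hpos
  let f : V ≃ₗ[ℝ] V := LinearEquiv.ofBijective f₀ ⟨hinj, LinearMap.injective_iff_surjective.mp hinj⟩
  have hf : ∀ x : V, f x = f₀ x := fun x => rfl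
  /- «by the proof of the first statement of the previous lemma it would then follow that there exists `c ∈ C^×` conjugating `h` into
  `h′` and such that `⟨v, w⟩ = ⟨cv, cw⟩`» -/
  obtain ⟨g, hgρ, hgh, hgψ⟩ := Kottwitz1992_4_2_iso_holds B V ρ ψ ψ η η' hposB
    ⟨f, fun b x => by rw [hf, hf, ← Module.End.mul_apply, hfρ, Module.End.mul_apply],
      fun z x => by rw [hf, hf, ← Module.End.mul_apply, hfz, Module.End.mul_apply]⟩
  exact ⟨g, hgρ, hgψ, hgh⟩

end Literature.NumberTheory.Kottwitz1992.HermitianSymmetricSpaces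

end
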